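import Mathlib

/-!
# `M Mᵀ = k·I` on `4q + 2` coordinates forces `k` to be a sum of two squares (Raghavarao / Geramita–Seberry), elementary kernel proof

Framing: lottery ticket; floor = certified bounds/negative ranges.

Cell pub-namedobj (venture DiscreteObjects), target (H), hadamard gen 13; HANDOFF-H-g12 open item 3 ('Geramita–Seberry
condition … NOT formalised; would need Hasse–Minkowski/Witt').  PRINT STATUS: the statement 'if `n ≡ 2 (mod 4)` and a weighing
matrix `W(n,k)` exists then `k` is a sum of two squares' is a KNOWN THEOREM (Raghavarao 1960 for conference matrices;
Geramita–Seberry, *Orthogonal Designs* (1979), for `W(n,k)`; cf. Ohmori 1992, Hiroshima Math. J., p. 2, and Winterhof et al.,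
EJC 2004, p. 2: 'a number theoretic consequence of applying Witt's cancellation to `W Wᵀ = wI`').  The kernel proof below is
ours and ELEMENTARY — no quadratic-form theory: it is the variable-elimination trick of the textbook proof of the
Bruck–Ryser–Chowla theorem [cite: VanLintWilson2001, Thm 19.11 (proof)] combined with Lagrange's four-square theorem
(Mathlib `Nat.sum_four_squares`) and the quaternion `4 × 4` matrix.  We prove the statement for ARBITRARY rational square
matrices (no `{0, ±1}` restriction):

* `elim_fin`, `elim` — ELIMINATION LEMMA: if affine forms `z ↦ (A z)ᵢ + bᵢ` (`i ∈ β`, variables indexed by the same finite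
  `β`) and any function `Φ` satisfy `Σᵢ ((A z)ᵢ + bᵢ)² + Φ z = Σᵢ zᵢ² + c` identically in `z : β → ℚ`, then `Φ z = c` for
  some `z` (induction: restrict to the hyperplane `z₀ = ℓ(z')` on which the first form equals `±z₀`, which exists because its
  `z₀`-coefficient is either `≠ 1` or `≠ −1`);
* `sq_add_sq_of_mul_transpose_self` — if `W : Matrix α α ℚ`, `W Wᵀ = k·1` and `|α| ≡ 2 (mod 4)`, then `k = u² + v²` with
  `u, v ∈ ℚ` (write `|α| = 4q + 2`, `k = a² + b² + c² + d²`; substitute `x = (k⁻¹ Bᵀ y, 1, 0)` blockwise with the quaternion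
  matrix `B`, `B Bᵀ = k·1`, so that `|Wᵀ x|² = k|x|² = |y|² + k`; eliminate the `4q` coordinates `y`);
* `nat_eq_sq_add_sq_of_rat` — an `N ∈ ℕ` that is a sum of two rational squares is a sum of two natural squares (via Mathlib's
  `Nat.eq_sq_add_sq_iff`: the `q`-adic valuation of `N·D²` at a prime `q ≡ 3 (mod 4)` is even);
* `nat_sq_add_sq_of_int_mul_transpose_self` — INTEGER form: `M : Matrix α α ℤ`, `M Mᵀ = N·1`, `|α| ≡ 2 (mod 4)` ⇒
  `N = x² + y²` in `ℕ`; `no_int_mul_transpose_self_of_not_sq_add_sq` — contrapositive.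
Application (companion file `InvolutionCensus668Mod8`): the type-I involution census of `H(668)` — the `t × t` matrix `B` of
`InvolutionDet` has `B Bᵀ = 668·I` and `668 = 4·167` is not a sum of two squares, so `t ≡ 0 (mod 4)`, i.e. `f ≡ 4 (mod 8)`.
Ours (formalisation and proof route); classical content; no `sorry`.
-/

namespace Summit.Ventures.DiscreteObjects.Hadamard

open Finset BigOperators Matrix

section elimination

/-- **Elimination lemma, `Fin m` version** (the Ryser / van Lint–Wilson trick [cite: VanLintWilson2001, Thm 19.11 (proof)]):
if `Σᵢ ((A z)ᵢ + bᵢ)² + Φ z = Σᵢ zᵢ² + c` for all `z : Fin m → ℚ`, then `Φ z = c` for some `z`. -/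
theorem elim_fin (m : ℕ) : ∀ (A : Matrix (Fin m) (Fin m) ℚ) (b : Fin m → ℚ) (Φ : (Fin m → ℚ) → ℚ) (c : ℚ),
    (∀ z, ∑ i, ((A *ᵥ z) i + b i) ^ 2 + Φ z = ∑ i, z i ^ 2 + c) → ∃ z, Φ z = c := by
  induction m with
  | zero =>
    intro A b Φ c h
    refine ⟨0, ?_⟩
    simpa using h 0
  | succ m ih =>
    intro A b Φ c h
    -- expansion of `A (t :: z')` along the first column
    have hmv : ∀ (t : ℚ) (z' : Fin m → ℚ) (i : Fin (m + 1)),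
        (A *ᵥ Fin.cons t z') i = A i 0 * t + ∑ j, A i j.succ * z' j := by
      intro t z' i
      simp [mulVec, dotProduct, Fin.sum_univ_succ]
    -- the first form is `c₀ t + d z'`; choose `t = σ z' = γ · d z'` with `c₀ σ + d = ± σ`
    set c₀ : ℚ := A 0 0 with hc₀
    set γ : ℚ := if c₀ = 1 then -(1 / 2) else 1 / (1 - c₀) with hγ
    set d : (Fin m → ℚ) → ℚ := fun z' => ∑ j, A 0 j.succ * z' j + b 0 with hd
    set σ : (Fin m → ℚ) → ℚ := fun z' => γ * d z' with hσ
    have hkey : ∀ z', ((A *ᵥ Fin.cons (σ z') z') 0 + b 0) ^ 2 = (σ z') ^ 2 := by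
      intro z'
      rw [hmv]
      have hval : A 0 0 * σ z' + ∑ j, A 0 j.succ * z' j + b 0 = c₀ * (γ * d z') + d z' := by
        simp only [hσ, hd, hc₀]; ring
      rw [hval]
      by_cases h1 : c₀ = 1
      · have hγ' : γ = -(1 / 2) := by simp [hγ, h1]
        rw [h1, hγ']
        simp only [hσ, hγ']
        ring
      · have hne : (1 : ℚ) - c₀ ≠ 0 := sub_ne_zero.mpr (Ne.symm h1)
        have hγ' : γ = 1 / (1 - c₀) := by simp [hγ, h1]
        have hlin : c₀ * (γ * d z') + d z' = γ * d z' := by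
          rw [hγ']
          field_simp
          ring
        rw [hlin]
    -- the remaining forms restricted to the hyperplane are affine in `z'`
    set A' : Matrix (Fin m) (Fin m) ℚ := fun i j => A i.succ 0 * (γ * A 0 j.succ) + A i.succ j.succ with hA'
    set b' : Fin m → ℚ := fun i => A i.succ 0 * (γ * b 0) + b i.succ with hb'
    have hrow : ∀ z' (i : Fin m), (A *ᵥ Fin.cons (σ z') z') i.succ + b i.succ = (A' *ᵥ z') i + b' i := by
      intro z' i
      have e1 : (A' *ᵥ z') i = A i.succ 0 * (γ * ∑ j, A 0 j.succ * z' j) + ∑ j, A i.succ j.succ * z' j := by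
        simp only [hA', mulVec, dotProduct]
        rw [Finset.mul_sum, Finset.mul_sum, ← Finset.sum_add_distrib]
        exact Finset.sum_congr rfl (fun j _ => by ring)
      rw [hmv, e1]
      simp only [hσ, hd, hb']
      ring
    have h' : ∀ z', ∑ i, ((A' *ᵥ z') i + b' i) ^ 2 + Φ (Fin.cons (σ z') z') = ∑ i, z' i ^ 2 + c := by
      intro z'
      have hz := h (Fin.cons (σ z') z')
      rw [Fin.sum_univ_succ, Fin.sum_univ_succ, hkey] at hz
      simp only [Fin.cons_zero, Fin.cons_succ] at hz
      rw [Finset.sum_congr rfl fun i _ => by rw [hrow z' i]] at hz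
      linarith
    obtain ⟨z', hz'⟩ := ih A' b' (fun z' => Φ (Fin.cons (σ z') z')) c h'
    exact ⟨Fin.cons (σ z') z', hz'⟩

/-- **Elimination lemma** over an arbitrary finite index type (transfer of `elim_fin` along `Fintype.equivFin`). -/
theorem elim {β : Type*} [Fintype β] (A : Matrix β β ℚ) (b : β → ℚ) (Φ : (β → ℚ) → ℚ) (c : ℚ)
    (h : ∀ z, ∑ i, ((A *ᵥ z) i + b i) ^ 2 + Φ z = ∑ i, z i ^ 2 + c) : ∃ z, Φ z = c := by
  classical
  set m := Fintype.card β
  let e : β ≃ Fin m := Fintype.equivFin β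
  have hA : ∀ (w : Fin m → ℚ) (i : Fin m),
      ((A.submatrix e.symm e.symm) *ᵥ w) i = (A *ᵥ (w ∘ e)) (e.symm i) := by
    intro w i
    simp only [mulVec, dotProduct, submatrix_apply, Function.comp]
    exact Fintype.sum_equiv e.symm _ _ (fun j => by simp)
  have h' : ∀ w : Fin m → ℚ,
      ∑ i, (((A.submatrix e.symm e.symm) *ᵥ w) i + b (e.symm i)) ^ 2 + Φ (w ∘ e) = ∑ i, w i ^ 2 + c := by
    intro w
    calc ∑ i, (((A.submatrix e.symm e.symm) *ᵥ w) i + b (e.symm i)) ^ 2 + Φ (w ∘ e)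
        = ∑ i : β, ((A *ᵥ (w ∘ e)) i + b i) ^ 2 + Φ (w ∘ e) := by
          congr 1
          symm
          refine Fintype.sum_equiv e _ _ (fun x => ?_)
          rw [hA, Equiv.symm_apply_apply]
      _ = ∑ i : β, (w ∘ e) i ^ 2 + c := h _
      _ = ∑ i, w i ^ 2 + c := by
          congr 1
          exact Fintype.sum_equiv e _ _ (fun x => rfl)
  obtain ⟨w, hw⟩ := elim_fin m (A.submatrix e.symm e.symm) (fun i => b (e.symm i)) (fun w => Φ (w ∘ e)) c h'
  exact ⟨w ∘ e, hw⟩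

end elimination

section gram

/-- `|M v|² = k |v|²` when `Mᵀ M = k·1` -/
theorem dotProduct_mulVec_self {m n : Type*} [Fintype m] [Fintype n] [DecidableEq n] (M : Matrix m n ℚ) (k : ℚ)
    (hM : Mᵀ * M = k • (1 : Matrix n n ℚ)) (v : n → ℚ) : (M *ᵥ v) ⬝ᵥ (M *ᵥ v) = k * (v ⬝ᵥ v) := by
  calc (M *ᵥ v) ⬝ᵥ (M *ᵥ v) = (v ᵥ* Mᵀ) ⬝ᵥ (M *ᵥ v) := by rw [vecMul_transpose]
    _ = v ⬝ᵥ (Mᵀ *ᵥ (M *ᵥ v)) := (dotProduct_mulVec _ _ _).symm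
    _ = v ⬝ᵥ ((Mᵀ * M) *ᵥ v) := by rw [mulVec_mulVec]
    _ = k * (v ⬝ᵥ v) := by rw [hM, smul_mulVec, one_mulVec, dotProduct_smul, smul_eq_mul]

/-- a nonnegative rational is a sum of four rational squares (Lagrange) -/
theorem exists_rat_four_sq (k : ℚ) (hk : 0 ≤ k) : ∃ a b c d : ℚ, a ^ 2 + b ^ 2 + c ^ 2 + d ^ 2 = k := by
  obtain ⟨a, b, c, d, h⟩ := Nat.sum_four_squares (k.num.toNat * k.den)
  have hden : (k.den : ℚ) ≠ 0 := Nat.cast_ne_zero.mpr k.den_ne_zero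
  have hnum : ((k.num.toNat : ℕ) : ℤ) = k.num := Int.toNat_of_nonneg (Rat.num_nonneg.mpr hk)
  have hnum' : ((k.num.toNat : ℕ) : ℚ) = (k.num : ℚ) := by exact_mod_cast hnum
  have h' : (a : ℚ) ^ 2 + (b : ℚ) ^ 2 + (c : ℚ) ^ 2 + (d : ℚ) ^ 2 = (k.num : ℚ) * k.den := by
    rw [← hnum']; exact_mod_cast h
  refine ⟨a / k.den, b / k.den, c / k.den, d / k.den, ?_⟩
  have hk' : (k.num : ℚ) = k * k.den := by rw [Rat.mul_den_eq_num]
  field_simp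
  rw [h', hk']
  ring

/-- the quaternion matrix: `B Bᵀ = (a² + b² + c² + d²)·1` -/
theorem quaternionMatrix_mul_transpose (a b c d : ℚ) :
    (!![a, b, c, d; -b, a, -d, c; -c, d, a, -b; -d, -c, b, a] : Matrix (Fin 4) (Fin 4) ℚ) *
      (!![a, b, c, d; -b, a, -d, c; -c, d, a, -b; -d, -c, b, a] : Matrix (Fin 4) (Fin 4) ℚ)ᵀ
      = (a ^ 2 + b ^ 2 + c ^ 2 + d ^ 2) • (1 : Matrix (Fin 4) (Fin 4) ℚ) := by
  ext i j
  fin_cases i <;> fin_cases j <;>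
    simp [Matrix.mul_apply, Fin.sum_univ_four] <;> ring

/-- **Core case** on the index type `(Fin 4 × Fin q) ⊕ Fin 2`: `W Wᵀ = k·1`, `k = a² + b² + c² + d² ≠ 0` ⇒ `k = u² + v²`. -/
theorem sq_add_sq_of_mul_transpose_self_core (q : ℕ)
    (W : Matrix ((Fin 4 × Fin q) ⊕ Fin 2) ((Fin 4 × Fin q) ⊕ Fin 2) ℚ) (k : ℚ) (hk : k ≠ 0)
    (hW : W * Wᵀ = k • (1 : Matrix _ _ ℚ)) (a b c d : ℚ) (habcd : a ^ 2 + b ^ 2 + c ^ 2 + d ^ 2 = k) :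
    ∃ u v : ℚ, u ^ 2 + v ^ 2 = k := by
  -- quaternion block and the block-diagonal substitution
  set B : Matrix (Fin 4) (Fin 4) ℚ := !![a, b, c, d; -b, a, -d, c; -c, d, a, -b; -d, -c, b, a] with hBdef
  have hB : B * Bᵀ = k • (1 : Matrix (Fin 4) (Fin 4) ℚ) := by
    rw [hBdef, quaternionMatrix_mul_transpose, habcd]
  set M : Matrix (Fin 4 × Fin q) (Fin 4 × Fin q) ℚ := blockDiagonal (fun _ : Fin q => Bᵀ) with hMdef
  have hM : Mᵀ * M = k • (1 : Matrix _ _ ℚ) := by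
    rw [hMdef, blockDiagonal_transpose, ← blockDiagonal_mul]
    simp only [transpose_transpose, hB]
    have e1 : (fun _ : Fin q => k • (1 : Matrix (Fin 4) (Fin 4) ℚ)) = k • (1 : Fin q → Matrix (Fin 4) (Fin 4) ℚ) := rfl
    rw [e1, blockDiagonal_smul, blockDiagonal_one]
  set T : Matrix ((Fin 4 × Fin q) ⊕ Fin 2) (Fin 4 × Fin q) ℚ := fromRows (k⁻¹ • M) 0 with hTdef
  set x₀ : (Fin 4 × Fin q) ⊕ Fin 2 → ℚ := Sum.elim 0 ![1, 0] with hx₀def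
  set x : (Fin 4 × Fin q → ℚ) → ((Fin 4 × Fin q) ⊕ Fin 2 → ℚ) := fun z => T *ᵥ z + x₀ with hxdef
  -- |x z|² = k⁻¹ |z|² + 1
  have hnorm : ∀ z, x z ⬝ᵥ x z = k⁻¹ * (z ⬝ᵥ z) + 1 := by
    intro z
    have hxz : x z = Sum.elim ((k⁻¹ • M) *ᵥ z) ![1, 0] := by
      simp only [hxdef, hTdef, hx₀def, fromRows_mulVec, Matrix.zero_mulVec]
      ext (j | t) <;> simp
    rw [hxz]
    simp only [dotProduct, Fintype.sum_sum_type, Sum.elim_inl, Sum.elim_inr, Fin.sum_univ_two, Matrix.cons_val_zero,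
      Matrix.cons_val_one]
    have h1 : ∑ j, ((k⁻¹ • M) *ᵥ z) j * ((k⁻¹ • M) *ᵥ z) j = k⁻¹ * ∑ j, z j * z j := by
      have h2 := dotProduct_mulVec_self M k hM z
      simp only [dotProduct] at h2
      simp only [smul_mulVec, Pi.smul_apply, smul_eq_mul]
      calc ∑ j, k⁻¹ * (M *ᵥ z) j * (k⁻¹ * (M *ᵥ z) j) = k⁻¹ * k⁻¹ * ∑ j, (M *ᵥ z) j * (M *ᵥ z) j := by
            rw [Finset.mul_sum]; exact Finset.sum_congr rfl fun j _ => by ring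
        _ = k⁻¹ * ∑ j, z j * z j := by rw [h2]; field_simp
    rw [h1]
    ring
  -- the forms `Wᵀ (x z) = A z + bv`
  set A : Matrix ((Fin 4 × Fin q) ⊕ Fin 2) (Fin 4 × Fin q) ℚ := Wᵀ * T with hAdef
  set bv : (Fin 4 × Fin q) ⊕ Fin 2 → ℚ := Wᵀ *ᵥ x₀ with hbvdef
  have hWx : ∀ z, Wᵀ *ᵥ x z = A *ᵥ z + bv := by
    intro z
    simp only [hxdef, hAdef, hbvdef, mulVec_add, mulVec_mulVec]
  have hWW : (Wᵀ)ᵀ * Wᵀ = k • (1 : Matrix _ _ ℚ) := by rw [transpose_transpose]; exact hW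
  have hid : ∀ z, ∑ i, ((A *ᵥ z) i + bv i) ^ 2 = z ⬝ᵥ z + k := by
    intro z
    have h1 : ∑ i, ((A *ᵥ z) i + bv i) ^ 2 = (Wᵀ *ᵥ x z) ⬝ᵥ (Wᵀ *ᵥ x z) := by
      rw [hWx]; simp only [dotProduct, Pi.add_apply, pow_two]
    rw [h1, dotProduct_mulVec_self Wᵀ k hWW (x z), hnorm]
    field_simp
  -- split off the two extra coordinates and eliminate the `4q` variables
  set A₁ : Matrix (Fin 4 × Fin q) (Fin 4 × Fin q) ℚ := fun j => A (Sum.inl j) with hA₁def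
  set Φ : (Fin 4 × Fin q → ℚ) → ℚ := fun z => ∑ t : Fin 2, ((A *ᵥ z) (Sum.inr t) + bv (Sum.inr t)) ^ 2 with hΦdef
  have hel : ∀ z, ∑ j, ((A₁ *ᵥ z) j + bv (Sum.inl j)) ^ 2 + Φ z = ∑ j, z j ^ 2 + k := by
    intro z
    have hz := hid z
    rw [Fintype.sum_sum_type] at hz
    have e2 : ∑ j, z j ^ 2 = z ⬝ᵥ z := by simp only [dotProduct, pow_two]
    rw [e2, ← hz]
    rfl
  obtain ⟨z, hzΦ⟩ := elim A₁ (fun j => bv (Sum.inl j)) Φ k hel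
  refine ⟨(A *ᵥ z) (Sum.inr 0) + bv (Sum.inr 0), (A *ᵥ z) (Sum.inr 1) + bv (Sum.inr 1), ?_⟩
  rw [← hzΦ, hΦdef]
  simp only [Fin.sum_univ_two]

/-- **`W Wᵀ = k·I` on `4q + 2` coordinates ⇒ `k` is a sum of two rational squares** (Raghavarao / Geramita–Seberry, here
for arbitrary rational square matrices; elementary proof). -/
theorem sq_add_sq_of_mul_transpose_self {α : Type*} [Fintype α] [DecidableEq α] (W : Matrix α α ℚ) (k : ℚ)
    (hW : W * Wᵀ = k • (1 : Matrix α α ℚ)) (hα : Fintype.card α % 4 = 2) : ∃ u v : ℚ, u ^ 2 + v ^ 2 = k := by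
  -- `k ≥ 0` from a diagonal entry, hence a sum of four squares
  have hne : Nonempty α := Fintype.card_pos_iff.mp (by omega)
  obtain ⟨i₀⟩ := hne
  have hk0 : 0 ≤ k := by
    have h := congrFun (congrFun hW i₀) i₀
    rw [Matrix.mul_apply, Matrix.smul_apply, Matrix.one_apply_eq, smul_eq_mul, mul_one] at h
    rw [← h]
    exact Finset.sum_nonneg fun j _ => by rw [transpose_apply]; exact mul_self_nonneg _
  by_cases hk : k = 0
  · exact ⟨0, 0, by rw [hk]; ring⟩
  obtain ⟨a, b, c, d, habcd⟩ := exists_rat_four_sq k hk0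
  -- reindex `α ≃ (Fin 4 × Fin q) ⊕ Fin 2`
  set q := Fintype.card α / 4 with hq
  have hcard : Fintype.card α = Fintype.card ((Fin 4 × Fin q) ⊕ Fin 2) := by
    simp only [Fintype.card_sum, Fintype.card_prod, Fintype.card_fin]
    omega
  let e : α ≃ (Fin 4 × Fin q) ⊕ Fin 2 := Fintype.equivOfCardEq hcard
  have hW' : W.submatrix e.symm e.symm * (W.submatrix e.symm e.symm)ᵀ = k • (1 : Matrix _ _ ℚ) := by
    rw [transpose_submatrix, submatrix_mul_equiv, hW, submatrix_smul, Pi.smul_apply, Pi.smul_apply,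
      submatrix_one_equiv]
  exact sq_add_sq_of_mul_transpose_self_core q _ k hk hW' a b c d habcd

end gram

section nat

/-- a natural number which is a sum of two rational squares is a sum of two natural squares -/
theorem nat_eq_sq_add_sq_of_rat {N : ℕ} {u v : ℚ} (h : u ^ 2 + v ^ 2 = N) : ∃ x y : ℕ, N = x ^ 2 + y ^ 2 := by
  -- clear denominators: X² + Y² = N D²
  set D : ℕ := u.den * v.den with hD
  have hD0 : D ≠ 0 := mul_ne_zero u.den_ne_zero v.den_ne_zero
  set X : ℤ := u.num * v.den with hX
  set Y : ℤ := v.num * u.den with hY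
  have hQ : (X : ℚ) ^ 2 + (Y : ℚ) ^ 2 = (N : ℚ) * (D : ℚ) ^ 2 := by
    simp only [hX, hY, hD]
    push_cast
    rw [← Rat.mul_den_eq_num u, ← Rat.mul_den_eq_num v, ← h]
    ring
  have hZ : X ^ 2 + Y ^ 2 = (N : ℤ) * (D : ℤ) ^ 2 := by exact_mod_cast hQ
  have hN : N * D ^ 2 = X.natAbs ^ 2 + Y.natAbs ^ 2 := by
    have h1 : ((X.natAbs ^ 2 + Y.natAbs ^ 2 : ℕ) : ℤ) = ((N * D ^ 2 : ℕ) : ℤ) := by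
      push_cast
      rw [sq_abs, sq_abs, hZ]
    exact (Nat.cast_inj.mp h1).symm
  by_cases hN0 : N = 0
  · exact ⟨0, 0, by rw [hN0]; ring⟩
  have hsq : ∃ x y, N * D ^ 2 = x ^ 2 + y ^ 2 := ⟨_, _, hN⟩
  rw [Nat.eq_sq_add_sq_iff] at hsq
  rw [Nat.eq_sq_add_sq_iff]
  intro p hp hp3
  have hpP : p.Prime := Nat.prime_of_mem_primeFactors hp
  haveI := Fact.mk hpP
  have hmem : p ∈ (N * D ^ 2).primeFactors :=
    Nat.mem_primeFactors.mpr ⟨hpP, dvd_mul_of_dvd_left (Nat.dvd_of_mem_primeFactors hp) _, by positivity⟩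
  have hev := hsq p hmem hp3
  rw [padicValNat.mul hN0 (pow_ne_zero _ hD0), padicValNat.pow] at hev
  exact (Nat.even_add.mp hev).mpr (even_two_mul _)

/-- **Integer form (Raghavarao / Geramita–Seberry for arbitrary integer matrices).**  If `M : Matrix α α ℤ` with
`|α| ≡ 2 (mod 4)` satisfies `M Mᵀ = N·1`, then `N` is a sum of two squares.  (For `M` a weighing matrix `W(n, k)`,
`n ≡ 2 (mod 4)`: `k = x² + y²`.) -/
theorem nat_sq_add_sq_of_int_mul_transpose_self {α : Type*} [Fintype α] [DecidableEq α] (M : Matrix α α ℤ) (N : ℕ)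
    (hM : M * Mᵀ = (N : ℤ) • (1 : Matrix α α ℤ)) (hα : Fintype.card α % 4 = 2) : ∃ x y : ℕ, N = x ^ 2 + y ^ 2 := by
  set W : Matrix α α ℚ := M.map (Int.castRingHom ℚ) with hWdef
  have hW : W * Wᵀ = (N : ℚ) • (1 : Matrix α α ℚ) := by
    have h1 : W * Wᵀ = (M * Mᵀ).map (Int.castRingHom ℚ) := by
      rw [Matrix.map_mul, hWdef, transpose_map]
    rw [h1, hM]
    ext i j
    rw [Matrix.map_apply, Matrix.smul_apply, Matrix.smul_apply, Matrix.one_apply, Matrix.one_apply]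
    split_ifs <;> simp
  obtain ⟨u, v, huv⟩ := sq_add_sq_of_mul_transpose_self W (N : ℚ) hW hα
  exact nat_eq_sq_add_sq_of_rat huv

/-- **Contrapositive**: if `N` is not a sum of two squares, no integer matrix on `4q + 2` coordinates has `M Mᵀ = N·1`. -/
theorem no_int_mul_transpose_self_of_not_sq_add_sq {α : Type*} [Fintype α] [DecidableEq α] (N : ℕ)
    (hN : ¬ ∃ x y : ℕ, N = x ^ 2 + y ^ 2) (hα : Fintype.card α % 4 = 2) (M : Matrix α α ℤ) :
    M * Mᵀ ≠ (N : ℤ) • (1 : Matrix α α ℤ) :=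
  fun hM => hN (nat_sq_add_sq_of_int_mul_transpose_self M N hM hα)

/-- `668 = 4·167` is not a sum of two natural squares -/
theorem not_sq_add_sq_668_nat : ¬ ∃ x y : ℕ, 668 = x ^ 2 + y ^ 2 := by
  rintro ⟨x, y, h⟩
  have hx : x ≤ 26 := by nlinarith
  have hy : y ≤ 26 := by nlinarith
  interval_cases x <;> interval_cases y <;> omega

/-- **No integer matrix `M` on `4q + 2` coordinates satisfies `M Mᵀ = 668·1`** — in particular no weighing matrix
`W(4q + 2, 167)` scaled by `2`, the shape produced by a type-I involution of a Hadamard matrix of order `668`. -/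
theorem no_int_mul_transpose_self_668 {α : Type*} [Fintype α] [DecidableEq α] (hα : Fintype.card α % 4 = 2)
    (M : Matrix α α ℤ) : M * Mᵀ ≠ (668 : ℤ) • (1 : Matrix α α ℤ) := by
  have h := no_int_mul_transpose_self_of_not_sq_add_sq 668 not_sq_add_sq_668_nat hα M
  exact_mod_cast h

end nat

end Summit.Ventures.DiscreteObjects.Hadamard
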